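import Summits.SmoothPoincare4.SmoothPoincare4.Theses.InformationMetricHadamard
import Summits.SmoothPoincare4.SmoothPoincare4.Theorems.InformationMetricHadamardC0AhRecognitionStubFarCollarImmersive
import Summits.SmoothPoincare4.SmoothPoincare4.Theorems.InformationMetricHadamardC0AhRecognitionStubFarCollarIsFar
import Summits.SmoothPoincare4.SmoothPoincare4.Theorems.InformationMetricHadamardC0AhRecognitionStubFarCollarPackage
import Summits.SmoothPoincare4.SmoothPoincare4.Theorems.InformationMetricHadamardC0AhRecognitionStubNearestPointSpread
import Summits.SmoothPoincare4.SmoothPoincare4.Theorems.InformationMetricHadamardC0AhRecognitionStubNearLevelSection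
import Summits.SmoothPoincare4.SmoothPoincare4.Theorems.InformationMetricHadamardC0AhRecognitionStubExpDifferentialNormGe
import Summits.SmoothPoincare4.SmoothPoincare4.Theorems.InformationMetricHadamardC0AhRecognitionStubNormSubLeEdist
import Summits.SmoothPoincare4.SmoothPoincare4.Theorems.InformationMetricHadamardC0AhRecognitionStubFlowToRoundSphere
import Summits.SmoothPoincare4.SmoothPoincare4.Theorems.InformationMetricHadamardC0AhRecognitionStubGradientLikeField
import Literature.Geometry.Riemannian.CartanHadamardConjugate

/-!
# Line `core-distance-morse` — skeleton for crux `InformationMetricHadamard.C0AhRecognition`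

(item stmt-SmoothPoincare4-6015, route `InformationMetricHadamard`, rank 3; idea card
`Cruxes/C0AhRecognition/Ideas/core-distance-morse.md` (ideator 2), triage `TRIAGE-r1-1.md`,
`TRIAGE-r1-2.md` (both pass), lead groundwork `Cruxes/C0AhRecognition/NOTES.md`,
`SketchLeadCoreDistanceMorse.lean`, `Prep*.lean`; crux-plan by
`planner-cruxplan-stmt-SmoothPoincare4-6015-core-distance-morse-0`, 2026-08-16.)

Crux (fixed, never restated): if a homotopy 4-sphere `Σ`, with a Riemannian metric `g`, is the
cross-section of a proper end collar `Φ : Σ × (0,1) → W` of a Cartan–Hadamard 5-manifold `(W, G)`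
(complete, simply connected, `sec ≤ 0`) on which `G` is `C⁰`-asymptotic to `c (dλ² + g)/λ²`, then
`Σ ≅ S⁴`.

## The line: noncritical Morse theory of the distance to a far core

Write `K_s := (Φ(Σ × (0,s)))ᶜ` (far core), `N_s := Φ(Σ × {s})` (slice), `f := d_G(·, K_s)`
(written below as `⨅ k ∈ K_s, G.edist hG · k`). The lever: the `C⁰` clause (read as a
`(1 ± 1/20)` length sandwich against the cone metric) makes `f` SUBCRITICAL in the sense of
Grove–Shiohama — any two nearest points `k₁, k₂ ∈ K_s` of a deep point `y` satisfy
`d_G(k₁, k₂) ≤ ρ · d_G(y, K_s)` with `ρ = 0.69 < √2` (planar Minkowski inequality, scale-invariant,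
no pointwise control of `G` needed) — and in a Cartan–Hadamard manifold a subcritical distance
function has a smooth complete gradient-like field, radial far out, whose flow carries the tiny
level `{f = a} ≅ N_s ≅ Σ` (one-sided tubular neighbourhood of the smooth compact slice) onto a far
geodesic sphere `S(o, R) ≅ S⁴`.

Registered stubs (2 collar lemmas, the first lemma, and the engine split near / field / flow):

* `stub_farCollarPackage` (P; M; the lead's `PrepFarCollarPackage.lean` proves essentially all of
  it): far-only immersivity + far-is-far ⇒ far parts open, `cl Φ(N×(0,s)) = Φ(N×(0,s])`,
  `∂K_s = slice`, `(interior K_s) ≠ ∅`, and the slice map is a smooth injective immersion.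
* `stub_nearestPointSpread` (N; M–L; the first lemma of the idea): `∃ ρ < √2`, for all small `s`,
  nearest points on `K_s` of any deep point `y` are `ρ · d(y, K_s)`-close (Minkowski form, `ε = 1/20`,
  `ρ = 2r√(r²−1) + slack`, `r² = 21/19`; real-analysis core in `PrepNearestPointSpread.lean`).
* `stub_nearLevelSection` (E2; L–XL): for `s` below the immersivity threshold and `a` small, the
  level `{f = a}` is the image of a smooth injective immersion of `N` (one-sided tubular
  neighbourhood of the compact embedded slice `N_s = ∂K_s`; `K_s` lies on one side by the collar).
* `stub_expDifferentialNormGe` (R; L; reshaped in by lead a1, 2026-08-16): the Rauch comparison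
  for `K ≤ 0` in its simplest form — `|d(exp_p)_v w|_G ≥ |w|_{G_p}` (Jacobi field `J(t) =
  d(exp_p)_{tv}(tw)` has `|J|` convex; the tree's `CartanHadamard.mfderiv_expMap_injective`
  proves the first half: `g(D_tJ, J)` nondecreasing). Input of E1 (gives: `exp_y⁻¹` is
  `1`-Lipschitz, hence CAT(0)-type angle comparison). Not in the tree (survey 2026-08-16).
* `stub_normSubLeEdist` (L; M; reshaped in by lead a1): calibration — a diffeomorphism `Φ : ℝ⁵ ≅ W`
  whose differential does not decrease `G_y`-lengths has a `1`-Lipschitz inverse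
  `(W, d_G) → (ℝ⁵, |·|_{G_y})`; with R (`Φ = exp_y`) this is the CAT(0) input of E1.
* `stub_gradientLikeField` (E1; XL; HARDEST — Grove–Shiohama in the Hadamard setting): `(W,G)`
  Cartan–Hadamard, `K` compact with the `ρ`-spread property (`ρ < √2`) ⇒ for every `a > 0` a smooth
  field `X`, `|X|_G ≤ 1`, along whose integral curves `f` grows at rate `≥ δ` on `{f ≥ a}`, and which
  is the unit radial field `e_*(v/|v|_o)` outside the `e`-image of the `G_o`-ball of radius `R₀`,
  `e : ℝ⁵ ≅ W` a polar diffeomorphism at `o` (`e 0 = o`, `d(o, e v) = |v|_{G_o}`; intended `e = exp_o`,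
  tree `HadamardConvex.exists_expDiffeomorph` + `edist_expMap_eq`). Inputs not in the tree: CAT(0)
  angle comparison (`exp_y⁻¹` is `1`-Lipschitz for `sec ≤ 0`), Danskin/Dini monotonicity of
  `f = min_k d_k`, patching by a smooth partition of unity.
* `stub_flowToRoundSphere` (E3; L–XL): such a field (complete since `|X| ≤ 1` and closed balls are
  compact) flows any compact `N` injectively immersed onto a level `{f = a}` diffeomorphically onto
  the `G_o`-sphere `{|v|_o = R}` (hitting map; Lyapunov ⇒ injective and transversal; local diffeo of
  closed 4-manifolds onto a connected one), which is `≅ S⁴`; tree: `exists_contMDiff_globalFlow_of_complete`,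
  `exists_isMIntegralCurve_of_apriori_isCompact`, 6016's radial files.

STATUS (lead a1, 2026-08-16): ALL SEVEN STUBS LANDED and imported below — P p117424, N p120988,
E2 p123840, R p121637, L p122030, E3 p125064, E1 (apex, lead; helpers Aux1–Aux6 + main file).
This file is now `sorry`-free: `C0AhRecognition_of` proves the crux by name.

Proved here (no `sorry` of its own): `C0AhRecognition_of` — the crux BY NAME from the five stubs,
the two LANDED stubs of line `Sketch` (`Sketch.stub_farCollarImmersive`, p110749;
`Sketch.stub_farCollarIsFar`, p112347; imported, not re-registered) and bookkeeping.

## Disproof.lean honoured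

None exists for this crux (`ledger crux ls stmt-SmoothPoincare4-6015`, 2026-08-16: no
`Disproof.lean`; payload `disproof_path` does not resolve on this hub). Standing negative evidence
= the refuter's TwistNote (evidence on the item; summarised in both TRIAGE files): no far sublevel
`K_t` is `G`-convex, metric spheres are non-graphical over slices, radial projection of a slice is
non-immersive. No stub here asserts any of these: N is a three-point LENGTH inequality (stable under
`(1±ε)` bi-Lipschitz changes, holds in TwistNote's `F^*G_hyp`), E2 works below the smoothness scale
of `(G, N_s)`, E1/E3 radially project a far LEVEL of `f` (transversality from CAT(0) alone) and reach
`N_s` through the flow, never along collar rays. `ledger negatives --problem SmoothPoincare4`: none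
of this route's items. Dead line `Sketch` (liouville-conformal-infinity) died at its transfer stub
`StandardSectionConeCollar` (crux-equivalent); nothing of it is used except the landed collar
lemmas A, C.
-/

noncomputable section

-- the prescribed namespace `Summit.<P>.<Sub>.…` duplicates `SmoothPoincare4` (P = Sub)
set_option linter.dupNamespace false

open scoped Manifold ContDiff Topology ENNReal NNReal
open Set Function

namespace Summit.SmoothPoincare4.SmoothPoincare4.Cruxes.C0AhRecognition.CoreDistanceMorse

open Literature.Topology.FourManifolds (HomotopySphere)
open Literature.Geometry.Lorentzian (PseudoRiemannianMetric IsGeodesicallyComplete)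
open Literature.Geometry.Riemannian (expMap)

/-! ## Stub P — the far collar package -/

-- `stub_farCollarPackage`: LANDED — see the imported Theorems module (stub closed).

/-! ## Stub N — the √2-spread of nearest points (first lemma of the idea) -/

-- `stub_nearestPointSpread`: LANDED — see the imported Theorems module (stub closed).

/-! ## Stub E2 — the tiny level of the core distance is a copy of the cross-section -/

-- `stub_nearLevelSection`: LANDED — see the imported Theorems module (stub closed).

/-! ## Stub R — Rauch comparison for `K ≤ 0`: `exp_p` does not decrease lengths (input of E1) -/

-- `stub_expDifferentialNormGe`: LANDED — see the imported Theorems module (stub closed).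

/-! ## Stub L — calibration: a length-nondecreasing parametrisation has a `1`-Lipschitz inverse (input of E1) -/

-- `stub_normSubLeEdist`: LANDED — see the imported Theorems module (stub closed).

/-! ## Stub E1 — Grove–Shiohama: a subcritical core distance has a gradient-like field (HARDEST) -/

-- `stub_gradientLikeField`: LANDED — see the imported Theorems module (stub closed).

/-! ## Stub E3 — the flow carries a compact level onto a round sphere -/

-- `stub_flowToRoundSphere`: LANDED — see the imported Theorems module (stub closed).

/-! ## The composition (kernel-checked; no `sorry` of its own) -/

/-- **Line `core-distance-morse` concludes the crux BY NAME.** Far immersivity (landed stub A of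
line `Sketch`) gives `t₀`; far-is-far (landed stub C) feeds stub P; stub N gives `ρ < √2` and a
threshold `t₁`; at the level `s = min(t₀,t₁)/2` stub P supplies the slice/frontier package, stub E2 a
level `{f = a}` parametrised by `Σ`, stub E1 the gradient-like field for `K_s` (its proof
consumes stub R), and stub E3 the diffeomorphism `Σ ≅ S⁴`. -/
theorem C0AhRecognition_of :
    Summit.SmoothPoincare4.SmoothPoincare4.Theses.InformationMetricHadamard.C0AhRecognition := by
  intro S g hg W _ _ _ _ _ _ G hG c Φ hc hcpt hsec hsm hinj hco hcl hasym
  -- the cross-section is nonempty (it is homotopy equivalent to `S⁴`)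
  haveI : Nonempty S.carrier := by
    obtain ⟨e⟩ := S.nonempty_homotopyEquiv
    obtain ⟨p, hp⟩ : (Metric.sphere (0 : EuclideanSpace ℝ (Fin 5)) 1).Nonempty :=
      NormedSpace.sphere_nonempty.2 zero_le_one
    exact ⟨e.invFun ⟨p, hp⟩⟩
  -- landed collar lemmas of line `Sketch`: far immersivity (A) and far-is-far (C)
  obtain ⟨t₀, ht₀, himm⟩ :=
    Sketch.stub_farCollarImmersive S.carrier g hg W G c Φ hc hasym
  have hfar : ∀ (x₀ : W) (R : NNReal), ∃ t ∈ Ioo (0 : ℝ) 1, ∀ (y : S.carrier) (l : ℝ),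
      l ∈ Ioo (0 : ℝ) t → (R : ℝ≥0∞) < G.edist hG x₀ (Φ (y, l)) :=
    Sketch.stub_farCollarIsFar S.carrier g hg W G hG c Φ hc hsm hinj ⟨t₀, ht₀, himm⟩ hasym
  -- stub P below `t₀`, stub N below `t₁`
  have hP := stub_farCollarPackage S.carrier W G hG Φ hsm hinj hcl t₀ ht₀ himm hfar
  obtain ⟨ρ, hρ, t₁, ht₁, hN⟩ :=
    stub_nearestPointSpread S.carrier g hg W G hG c Φ hc hcpt hsm hinj hco hcl hasym
  -- a level below both thresholds
  set s : ℝ := min t₀ t₁ / 2 with hs_def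
  have hmin : 0 < min t₀ t₁ := lt_min ht₀.1 ht₁.1
  have hs0 : 0 < s := by rw [hs_def]; linarith
  have hst₀ : s < t₀ := by rw [hs_def]; linarith [min_le_left t₀ t₁]
  have hst₁ : s < t₁ := by rw [hs_def]; linarith [min_le_right t₀ t₁]
  have hs1 : s < 1 := hst₀.trans ht₀.2
  obtain ⟨hopen, hclos, hfront, hKi, -, -, -⟩ := hP s ⟨hs0, hst₀⟩
  have hKc : IsCompact (Φ '' (univ ×ˢ Ioo (0 : ℝ) s))ᶜ := hco s ⟨hs0, hs1⟩
  have hKne : ((Φ '' (univ ×ˢ Ioo (0 : ℝ) s))ᶜ).Nonempty := hKi.mono interior_subset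
  -- stub E2: a tiny level `{f = a}` parametrised by `Σ`
  obtain ⟨a₀, ha₀, hE2⟩ :=
    stub_nearLevelSection S.carrier W G hG hcpt Φ hsm hinj t₀ ht₀ himm s ⟨hs0, hst₀⟩ hopen hclos
      hfront hKc
  have ha : 0 < a₀ / 2 := by linarith
  obtain ⟨j, hj, hjinj, hjimm, hjr⟩ := hE2 (a₀ / 2) ⟨ha, by linarith⟩
  -- stub E1: the gradient-like field for the far core `K_s`
  have hspread : ∀ y ∈ ((Φ '' (univ ×ˢ Ioo (0 : ℝ) s))ᶜ)ᶜ,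
      ∀ k₁ ∈ (Φ '' (univ ×ˢ Ioo (0 : ℝ) s))ᶜ, ∀ k₂ ∈ (Φ '' (univ ×ˢ Ioo (0 : ℝ) s))ᶜ,
        G.edist hG y k₁ = ⨅ k ∈ (Φ '' (univ ×ˢ Ioo (0 : ℝ) s))ᶜ, G.edist hG y k →
        G.edist hG y k₂ = ⨅ k ∈ (Φ '' (univ ×ˢ Ioo (0 : ℝ) s))ᶜ, G.edist hG y k →
        G.edist hG k₁ k₂ ≤
          ENNReal.ofReal ρ * ⨅ k ∈ (Φ '' (univ ×ˢ Ioo (0 : ℝ) s))ᶜ, G.edist hG y k := by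
    intro y hy
    rw [compl_compl] at hy
    exact hN s ⟨hs0, hst₁⟩ y hy
  obtain ⟨X, δ, o, R₀, e, hδ, hR₀, hX, hXle, hlyap, he0, hedist, hrad⟩ :=
    stub_gradientLikeField W G hG hcpt hsec _ hKc ρ hρ hspread (a₀ / 2) ha
  -- stub E3: flow the level onto a round sphere
  exact stub_flowToRoundSphere W G hG hcpt _ hKc hKne (a₀ / 2) ha X δ o R₀ e hδ hR₀ hX hXle hlyap
    he0 hedist hrad S.carrier j hj hjinj hjimm hjr

end Summit.SmoothPoincare4.SmoothPoincare4.Cruxes.C0AhRecognition.CoreDistanceMorse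

end
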